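import Summits.HubbardSuperconductivity.HubbardSuperconductivity.Theorems.WeakCouplingBCSWcbcsSsbToTorusLROReduction
import Literature.MathematicalPhysics.QuantumLattice.TorusPairSusceptibility

/-! # SPLIT T/N/C certificate, strategist s2 re-issue (2026-08-17): both filings of child C certified.
(1) children VERBATIM (= s1's SPLIT_TNC_certificate, needs the route-level import `TorusPairSusceptibility` for `pairGap` —
    route-closure test A FAILED without it: `Unknown identifier pairGap`; test B with it: rc 0);
(2) child C with `pairGap` UNFOLDED (import-free; route-closure test A2): `Iff.rfl` with (1) and the same glue p91563. -/

set_option linter.dupNamespace false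

namespace Summit.HubbardSuperconductivity.HubbardSuperconductivity.Theses.WeakCouplingBCS.SplitTNC2

open scoped BigOperators Topology Manifold Classical MeasureTheory ProbabilityTheory Matrix InnerProductSpace ComplexConjugate ContinuousMap
open Filter Set Function TopologicalSpace MeasureTheory

open Literature.Hubbard

/-- child 1 (crux, rank 2): torus pair stiffness (T), verbatim. -/
def WcbcsTorusPairStiffness : Prop :=
  ∃ U₀ : ℝ, 0 < U₀ ∧ ∀ U ∈ Set.Ioo (0:ℝ) U₀, ∀ δ ∈ Set.Ioo (0:ℝ) (1 / 2), ∀ μ : ℝ, Filter.Tendsto (fun L : ℕ => ((Literature.MathematicalPhysics.QuantumLattice.hubbardTorusWith 2 (L + 1) 1 U μ).groundStateFunctional Literature.MathematicalPhysics.QuantumLattice.totalNumber).re / ((L + 1 : ℕ) : ℝ) ^ 2) Filter.atTop (nhds (1 - δ)) → Literature.MathematicalPhysics.QuantumLattice.HasDWaveOrder U μ → ∃ C η : ℝ, 0 < η ∧ ∀ᶠ k : ℕ in Filter.atTop, ∀ ψ : Literature.MathematicalPhysics.QuantumLattice.Fock (Literature.MathematicalPhysics.QuantumLattice.Orb (Literature.MathematicalPhysics.QuantumLattice.FermionTorus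 2 (2 * k + 1 + 1))), Literature.MathematicalPhysics.QuantumLattice.IsGroundStateInSector (Literature.MathematicalPhysics.QuantumLattice.hubbardTorus 2 (2 * k + 1 + 1) 1 U) (2 * ⌊(1 - δ) * (((2 * k + 1 + 1) : ℕ) : ℝ) ^ 2 / 2⌋₊) 0 ψ → star ψ ⬝ᵥ ψ = 1 → ∀ m : Literature.Probability.LatticeModels.TorusSite 2 (2 * k + 1 + 1), m ≠ 0 → Literature.MathematicalPhysics.QuantumLattice.momentumNormSq (2 * k + 1 + 1) m < η ^ 2 → (∀ w : Literature.MathematicalPhysics.QuantumLattice.Fock (Literature.MathematicalPhysics.QuantumLattice.Orb (Literature.MathematicalPhysics.QuantumLattice.FermionTorus 2 (2 * k + 1 + 1))), w ∈ Literature.MathematicalPhysics.QuantumLattice.szSector (Λ := Literature.MathematicalPhysics.QuantumLattice.FermionTorus 2 (2 * k + 1 + 1)) (2 * ⌊(1 - δ) * (((2 * k + 1 + 1) : ℕ) : ℝ) ^ 2 / 2⌋₊ - 2) 0 → 2 * (star w ⬝ᵥ (Literature.MathematicalPhysics.QuantumLattice.pairFieldAt Literature.MathematicalPhysics.QuantumLattice.dWaveFormFactor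 (2 * k + 1 + 1) m *ᵥ ψ)).re - ((star w ⬝ᵥ (Literature.MathematicalPhysics.QuantumLattice.hubbardTorus 2 (2 * k + 1 + 1) 1 U *ᵥ w)).re - (Literature.MathematicalPhysics.QuantumLattice.hubbardTorus 2 (2 * k + 1 + 1) 1 U).minEnergyOn (Literature.MathematicalPhysics.QuantumLattice.szSector (2 * ⌊(1 - δ) * (((2 * k + 1 + 1) : ℕ) : ℝ) ^ 2 / 2⌋₊ - 2) 0) * (star w ⬝ᵥ w).re) ≤ C * (((2 * k + 1 + 1) : ℕ) : ℝ) ^ 2 / Literature.MathematicalPhysics.QuantumLattice.momentumNormSq (2 * k + 1 + 1) m) ∧ (∀ w : Literature.MathematicalPhysics.QuantumLattice.Fock (Literature.MathematicalPhysics.QuantumLattice.Orb (Literature.MathematicalPhysics.QuantumLattice.FermionTorus 2 (2 * k + 1 + 1))), w ∈ Literature.MathematicalPhysics.QuantumLattice.szSector (Λ := Literature.MathematicalPhysics.QuantumLattice.FermionTorus 2 (2 * k + 1 + 1)) (2 * ⌊(1 - δ) * (((2 * k + 1 + 1) : ℕ) : ℝ) ^ 2 / 2⌋₊ + 2) 0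 → 2 * (star w ⬝ᵥ ((Literature.MathematicalPhysics.QuantumLattice.pairFieldAt Literature.MathematicalPhysics.QuantumLattice.dWaveFormFactor (2 * k + 1 + 1) m)ᴴ *ᵥ ψ)).re - ((star w ⬝ᵥ (Literature.MathematicalPhysics.QuantumLattice.hubbardTorus 2 (2 * k + 1 + 1) 1 U *ᵥ w)).re - (Literature.MathematicalPhysics.QuantumLattice.hubbardTorus 2 (2 * k + 1 + 1) 1 U).minEnergyOn (Literature.MathematicalPhysics.QuantumLattice.szSector (2 * ⌊(1 - δ) * (((2 * k + 1 + 1) : ℕ) : ℝ) ^ 2 / 2⌋₊ + 2) 0) * (star w ⬝ᵥ w).re) ≤ C * (((2 * k + 1 + 1) : ℕ) : ℝ) ^ 2 / Literature.MathematicalPhysics.QuantumLattice.momentumNormSq (2 * k + 1 + 1) m)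

/-- child 2 (crux, rank 3): neutral-curvature floor (N), verbatim. -/
def WcbcsNeutralCurvature : Prop :=
  ∃ U₀ : ℝ, 0 < U₀ ∧ ∀ U ∈ Set.Ioo (0:ℝ) U₀, ∀ δ ∈ Set.Ioo (0:ℝ) (1 / 2), ∀ μ : ℝ, Filter.Tendsto (fun L : ℕ => ((Literature.MathematicalPhysics.QuantumLattice.hubbardTorusWith 2 (L + 1) 1 U μ).groundStateFunctional Literature.MathematicalPhysics.QuantumLattice.totalNumber).re / ((L + 1 : ℕ) : ℝ) ^ 2) Filter.atTop (nhds (1 - δ)) → Literature.MathematicalPhysics.QuantumLattice.HasDWaveOrder U μ → ∀ R : ℕ, 0 < R → ∃ C : ℝ, 0 ≤ C ∧ ∃ κ₀ : ℝ, 0 < κ₀ ∧ ∃ h₀ : ℝ, 0 < h₀ ∧ ∀ κ ∈ Set.Ioo (0:ℝ) κ₀, ∀ h ∈ Set.Ioo (0:ℝ) h₀, ∀ᶠ L : ℕ in Filter.atTop, -C * κ ^ 2 * ((L + 1 : ℕ) : ℝ) ^ 2 ≤ (Literature.MathematicalPhysics.QuantumLattice.dWaveSourceTorus (L + 1) U μ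 h + (κ : ℂ) • (((((R : ℝ) ^ 4)⁻¹ : ℝ) : ℂ) • ∑ a : Literature.Probability.LatticeModels.TorusSite 2 (L + 1), (∑ u : Fin 2 → Fin R, Literature.MathematicalPhysics.QuantumLattice.localPair Literature.MathematicalPhysics.QuantumLattice.dWaveFormFactor (L + 1) (a + fun i => ((u i : ℕ) : ZMod (L + 1))))ᴴ * (∑ u : Fin 2 → Fin R, Literature.MathematicalPhysics.QuantumLattice.localPair Literature.MathematicalPhysics.QuantumLattice.dWaveFormFactor (L + 1) (a + fun i => ((u i : ℕ) : ZMod (L + 1)))))).groundEnergy + (Literature.MathematicalPhysics.QuantumLattice.dWaveSourceTorus (L + 1) U μ h + ((-κ : ℝ) : ℂ) • (((((R : ℝ) ^ 4)⁻¹ : ℝ) : ℂ) • ∑ a : Literature.Probability.LatticeModels.TorusSite 2 (L + 1), (∑ u : Fin 2 → Fin R, Literature.MathematicalPhysics.QuantumLattice.localPair Literature.MathematicalPhysics.QuantumLattice.dWaveFormFactor (L + 1) (a + fun i => ((u i : ℕ) : ZMod (L + 1))))ᴴ * (∑ u : Fin 2 → Fin R, Literature.MathematicalPhysics.QuantumLattice.localPair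 Literature.MathematicalPhysics.QuantumLattice.dWaveFormFactor (L + 1) (a + fun i => ((u i : ℕ) : ZMod (L + 1)))))).groundEnergy - 2 * (Literature.MathematicalPhysics.QuantumLattice.dWaveSourceTorus (L + 1) U μ h).groundEnergy

/-- child 3 (crux, rank 4): charging floor (C), verbatim (uses `pairGap`). -/
def WcbcsChargingFloor : Prop :=
  ∃ U₀ : ℝ, 0 < U₀ ∧ ∀ U ∈ Set.Ioo (0:ℝ) U₀, ∀ δ ∈ Set.Ioo (0:ℝ) (1 / 2), ∀ μ : ℝ, Filter.Tendsto (fun L : ℕ => ((Literature.MathematicalPhysics.QuantumLattice.hubbardTorusWith 2 (L + 1) 1 U μ).groundStateFunctional Literature.MathematicalPhysics.QuantumLattice.totalNumber).re / ((L + 1 : ℕ) : ℝ) ^ 2) Filter.atTop (nhds (1 - δ)) → Literature.MathematicalPhysics.QuantumLattice.HasDWaveOrder U μ → ∀ ε : ℝ, 0 < ε → ∀ᶠ k : ℕ in Filter.atTop, -ε ≤ (1 + Real.log (((2 * k + 1 + 1) : ℕ) : ℝ)) * Literature.MathematicalPhysics.QuantumLattice.pairGap (Literature.MathematicalPhysics.QuantumLattice.hubbardTorus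 2 (2 * k + 1 + 1) 1 U) (2 * ⌊(1 - δ) * (((2 * k + 1 + 1) : ℕ) : ℝ) ^ 2 / 2⌋₊)

/-- child 3, import-free form (pairGap unfolded). -/
def WcbcsChargingFloorUnfolded : Prop :=
  ∃ U₀ : ℝ, 0 < U₀ ∧ ∀ U ∈ Set.Ioo (0:ℝ) U₀, ∀ δ ∈ Set.Ioo (0:ℝ) (1 / 2), ∀ μ : ℝ, Filter.Tendsto (fun L : ℕ => ((Literature.MathematicalPhysics.QuantumLattice.hubbardTorusWith 2 (L + 1) 1 U μ).groundStateFunctional Literature.MathematicalPhysics.QuantumLattice.totalNumber).re / ((L + 1 : ℕ) : ℝ) ^ 2) Filter.atTop (nhds (1 - δ)) → Literature.MathematicalPhysics.QuantumLattice.HasDWaveOrder U μ → ∀ ε : ℝ, 0 < ε → ∀ᶠ k : ℕ in Filter.atTop, -ε ≤ (1 + Real.log (((2 * k + 1 + 1) : ℕ) : ℝ)) * (((Literature.MathematicalPhysics.QuantumLattice.hubbardTorus 2 (2 * k + 1 + 1) 1 U).minEnergyOn (Literature.MathematicalPhysics.QuantumLattice.szSector (2 * ⌊(1 - δ) * (((2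 * k + 1 + 1) : ℕ) : ℝ) ^ 2 / 2⌋₊ + 2) 0) + (Literature.MathematicalPhysics.QuantumLattice.hubbardTorus 2 (2 * k + 1 + 1) 1 U).minEnergyOn (Literature.MathematicalPhysics.QuantumLattice.szSector (2 * ⌊(1 - δ) * (((2 * k + 1 + 1) : ℕ) : ℝ) ^ 2 / 2⌋₊ - 2) 0) - 2 * (Literature.MathematicalPhysics.QuantumLattice.hubbardTorus 2 (2 * k + 1 + 1) 1 U).minEnergyOn (Literature.MathematicalPhysics.QuantumLattice.szSector (2 * ⌊(1 - δ) * (((2 * k + 1 + 1) : ℕ) : ℝ) ^ 2 / 2⌋₊) 0)) / 2)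

/-- the two forms of child C are definitionally the same statement. -/
theorem wcbcsChargingFloorUnfolded_iff : WcbcsChargingFloorUnfolded ↔ WcbcsChargingFloor := Iff.rfl

/-- glue for filing (1): the landed reduction p91563 by name. -/
theorem wcbcsSsbToTorusLRO_of_subs :
    WcbcsTorusPairStiffness → WcbcsNeutralCurvature → WcbcsChargingFloor → WcbcsSsbToTorusLRO :=
  Summit.HubbardSuperconductivity.HubbardSuperconductivity.Theorems.WcbcsSsbToTorusLRO.wcbcsSsbToTorusLRO_of_stiffness_curvature_charging

/-- glue for filing (2): the same landed reduction closes the import-free family. -/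
theorem wcbcsSsbToTorusLRO_of_subs_unfolded :
    WcbcsTorusPairStiffness → WcbcsNeutralCurvature → WcbcsChargingFloorUnfolded → WcbcsSsbToTorusLRO :=
  Summit.HubbardSuperconductivity.HubbardSuperconductivity.Theorems.WcbcsSsbToTorusLRO.wcbcsSsbToTorusLRO_of_stiffness_curvature_charging

end Summit.HubbardSuperconductivity.HubbardSuperconductivity.Theses.WeakCouplingBCS.SplitTNC2
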